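import Literature.MathematicalPhysics.QuantumFieldTheory.Balaban1983to89.B6Ineq2133TwoScaleV1
import Literature.MathematicalPhysics.QuantumFieldTheory.Balaban1983to89.B6BlockDecayK12V1
import Literature.MathematicalPhysics.QuantumFieldTheory.Balaban1983to89.B6HjGtOpNormV1
import Literature.MathematicalPhysics.QuantumFieldTheory.Balaban1983to89.B5PBridgeKernel126
import Literature.MathematicalPhysics.QuantumFieldTheory.BalabanImbrieJaffe1984to88.BIJ85Prop12BridgeGeometry

/-!
# `Balaban1983to89.B6Ineq288TwoScaleV1` — T. Bałaban, *Propagators and renormalization transformations for lattice gauge theories. II*,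
# Commun. Math. Phys. **96** (1984) 223–250 [Balaban1984PropagatorsII], (2.88) p. 238 FOR THE GENUINE TWO-SCALE PROJECTION `P_□` OF (2.90) p. 239:
# the kernel of `∂P_□∂*` decays exponentially, UNIFORMLY in the volume, the scale `j`, the region `Λ′ ⊂ T^{(j+1)}` — for the concrete
# two-scale data `tsV1` at the paper's scaling `c = η⁻¹ = L^j`, in the block-majorant shape consumed by the (2.134)/(2.91) files of Prop. 2.6

statement-level skeleton of published theorems with citation tags; proofs where landed; nothing here is a claim about the Yang–Mills mass gap

PDF held: `paper:balaban1984-cmp96-propagators-rt-ii` (journal page = PDF page + 222); p. 238 [PDF 16], p. 239 [PDF 17], pp. 240–242 [PDF 18–20],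
p. 247 [PDF 25] read AS IMAGES on the ×2 renders `run/shared/lean/pub/pub-balaban/b2b-balaban-ref1/pages/1984-cmp96-propagators-rt-II/` by this
seat (2026-08-23); `paper:balaban1984-cmp95-propagators-rt-i` ([4] = [Balaban1984PropagatorsI]; journal page = PDF page + 16), p. 38 (1.126).

PRINT (verbatim).  p. 238: *"Finally let us consider the kernel of the operator ∂P∂* appearing in ∂R∂*, R = I − P given by (2.18). We have from
Lemma 2.1, Proposition 2.2 and (2.87), |(∂P∂*)_{μν}(x, x′)| = |(∂_μG′Q′*(Q′G′²Q′*)⁻¹Q′G′∂*_ν)(x, x′)| ≦ … ≦ O(1)(L^jη)^{−2}(L^{j′}η)^{−d}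
e^{−δ₂d(y,y′)}, (2.88) where x ∈ B^j(y), x′ ∈ B^{j′}(y′), y ∈ Λ_j, y′ ∈ Λ_{j′}, and δ₂ is determined by δ₀, δ₁."*  p. 239: *"On this torus we
define operators R, Δ_a as in (2.17), (2.19), but only two scales are present now. … Let us denote by P_□ the projection operator in (2.17)
defined by the above Q′*aQ′, and G_□ = (Δ − ∂P_□∂* + Q*aQ)⁻¹. (2.90) … (K_{□,□}A)_μ(x) = … + (ζ_□(∂P∂* − ∂P_□∂*)h_□A)_μ(x) +
(ζ_□P_{□,1}(∂h_□)A)_μ(x). (2.92) … The operators S_j, P_{□,1}(∂h_□) = [∂P_□∂*, h_□] were defined in (1.120)."*  p. 247: *"Applying the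
inequalities (2.133), (2.88) and the remarks after the inequality (2.68) we obtain |(K_{□,□′}G_{□′}h_{□′}J)(x)| ≦ O(M⁻¹)e^{−½δ₂d(y,y′)}|J| (2.134)"*.
[4] p. 38: *"|(∂P∂*)_{μ,ν}(x, x′)| ≦ O(1)e^{−δ′₀|x−x′|}, (1.126) … The constant O(1) in (1.126) depends on d only"*.

CITATION HEADER (lean-in-tree rule) — WHAT IS REPRODUCED.  Phase-2 file of the `lit-balaban` typed skeleton (HOME `run/shared/lean/pub/lit-balaban/`),
seat **p22 gen 18** (free-target protocol G.5-34(d), TAKING line HOME/STATUS.md 2026-08-23T00:36Z; B6 fold owner r03, referee ref-4); SKELETON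
rows **B6.Eq2.88** × **B6.Eq2.90** / **B6.Eq2.92** × **B6.Prop2.6** (cells only; decls of record untouched: (2.88) at `k` levels on the Neumann box
is p21's `…B6Ineq288MultiLevelBox`, at one scale on the torus `…B6Ineq288OneScaleTorus`).  THIS FILE = the member instance the owner's design note
names (B6-CLOSURE.md §5 item 7 (d4): *«ζ_□P_{□,1}(∂h_□) = [∂P_□∂*, h_□] (NEW; needs a kernel bound of ∂P_□∂* on T_□)»*, item 9: the transplanted
`Pl := c•ε(grad ∘ P ∘ dv)ρ`; p38's `…B6Ineq2134DiagKLevel.ineq2134_diag_kLevel` hypothesis `hPl`): (2.88) for the GENUINE TWO-SCALE `P_□`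
of every member of the family (2.90) on p22's V1 carriers — `P = (tsV1 hc Λ′ w).P = I − R`, `R` the orthogonal projection onto `ΔN(Q′)`
(`…B6SectCOperators.TwoScaleData.R/P`, (2.10)/(2.17)), volume `(m, K)`, scale `j + 1 ≤ m + K`, `Λ′ ⊂ T^{(j+1)}` ARBITRARY, `c = L^j`.

ROUTE (honest: NOT print's).  Print derives (2.88) from Lemma 2.1, Proposition 2.2 and the random-walk expansion (2.87) of `(Q′G′²Q′*)⁻¹`; the tree
has the two-level (2.87) only on p21's integer box carriers, not on V1.  Here (2.88) for the two-scale `P_□` follows from SECT. C ITSELF: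
§1 (abstract, every `TwoScaleData` under `IsLattice` + `Positive`) the two-scale gauge space splits `N(Q′) = N(Q′_j) ⊕ H′_j(S₁)` ((2.105), p22 gen 8's
`NQ_decomp`) with `ΔH′_jω ⊥ ΔN(Q′_j)` ((2.98), `hP_orth`), hence **`R = R_j + ΔH′_jC^{(j)}_ΛH′_j*Δ`** (`C^{(j)}_Λ` = the covariance of `Δ′_j = H′_j*Δ²H′_j`
on the admissible `ω`, (2.106)–(2.110); `C_sol`, `inner_Dp`) and **`∂P∂* = ∂P_j∂* − (∂ΔH′_j)C^{(j)}_Λ(∂ΔH′_j)*`**; §2 the correction term has an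
exponentially decaying block kernel for `tsV1` at `c = L^j`, uniformly (gen 15's factor bounds `…B6BlockDecayHprimeCovV1.blockBound_gradLapHp(_adjoint)`,
`cov_entry_uniform` composed by gen 16's `…B6BlockDecayK12V1.blockBound_comp3` — the operator is `K₂` of (2.129) with `(∂H′_j)*` replaced by `(∂ΔH′_j)*`);
§3 the one-level `∂P_j∂*` IS [4]'s `∂P∂*` of (1.120)/(1.126) on r02's typed torus (gen 9's `…B6Eq2130TwoScaleV1Landau.Rj_eq_RE`, r03 g10's transport
`…B6GOneLevelV1Bridge.TV`/`form_R_TV`-pattern, p21's `…B5Identities197Torus.RT_mul_GradOp_adjoint`: the entries of `∂P_j∂*` are the real parts of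
the entries of `GradOp·PcT·GradOpᴴ`), so [4] (1.126) — p16 g6's `…B5PBridgeKernel126.norm_GradOp_PcT_GradOp_adjoint_le` (b05's uniform torus proof
of (1.126)) — bounds them by `C·n^{−(d+1)}e^{−δ′₀|x−x′|/n}`, and p09's `mul_supDist_blk_le` / p19's `distU_EK` turn the fine distance into the block
distance (§4 `abs_gradPjdv_entry_le`, `blockBound_gradPjdv_scaling`); §4 both pieces together: **`blockBound_gradPdv_scaling`** — ONE `δ > 0`, ONE
`A ≥ 0` depending on `d, L` only with `Σ_{b′ : y(b′₋) = y}|(∂P∂*)(e_{b′})(b)| ≤ A·e^{−δ|y(b₋) − y|_T}` for every member — and (§5) the consumer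
readings **`ineq288_twoScale`**
(`HasMajorant (fun b => iterBlockOf j b.src) (onFun (∂ ∘ P ∘ ∂*)) (fun y y′ => A·e^{−δ|y − y′|_T})` on p38's `tsGeo i R M` for every census member
`i : TSIdx`, the shape of p38's `ineq2133_G`) and `ineq288_twoScale_local` (`LocalMajorant` on any reach set).
IMPORTS BY NAME, restating nothing.  THEOREMS ONLY (no `def`, no `def … : Prop`, no new hypothesis); standard axioms.

DICTIONARY / HONEST SCOPE. (1) Units: the `ξ`-lattice of `T_□` (`L^jη = 1`, the tree's units for Prop. 2.5 / (2.133)): print's factors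
`(L^jη)^{−2}(L^{j′}η)^{−d}` of (2.88) read `1` resp. are absorbed in the unweighted `ℓ²` entries (print's kernel is taken w.r.t. `η^dΣ_{x′}`, (1.120));
the rescaling to the `η`-lattice / to a consumer's `c′`-units is the consumer's (r03's item 9 unit factors), NOT done here. (2) The distance is the torus
sup-distance `|y − y′|_T` of the `j`-blocks of `T_□` (print: the two-scale `d(y, y′)` of (2.46), which it dominates up to `d + 1`, cf. p22 gen 17's
`…B6TwoScaleGeometryV1`); the majorant is GLOBAL (all pairs of blocks), stronger than the local shape. (3) Two adjacent levels only (print's `P_□` has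
exactly two, p. 239 *"only two scales are present now"*); the global `k`-level `∂P∂*` of (2.92) line 3 is p21's/p38's (`…B6Ineq288MultiLevelBox.DP`),
the change-of-domain estimate of line 3 is p38's `…B6DomainChangeP2134` — neither is touched. (4) Constants existential, depending on `d, L` only
(print: *"O(1)"*, `δ₂(δ₀, δ₁)`); the weights `w` of the member do not enter (only `w > 0`, through `IsLattice`). (5) `P_□` here is the V1 orthogonal-projection
DEFINITION (2.10)/(2.17) (`I −` proj onto `ΔN(Q′)`), which print identifies with `G′Q′*(Q′G′²Q′*)⁻¹Q′G′` ((2.26)–(2.27)); that identification is NOT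
used.  NOT summit progress.  Unit `lit-balaban-p22` (gen 18), 2026-08-23.
-/

noncomputable section

open scoped InnerProductSpace BigOperators Matrix ComplexConjugate
open Finset

namespace Literature.MathematicalPhysics.QuantumFieldTheory.Balaban1983to89.B6Ineq288TwoScaleV1

open LatticeFieldCalculus B5SectBStatements B5Eq117TorusCarriers B6SectAOperatorsV1 B6SectCOperators B6SectCOperators.TwoScaleData
  B6SectCPositivity B6CovarianceOperator B6SectCTwoScaleV1 B6SectCTwoScaleV1Lattice B5Eq118OneStroke
open BalabanImbrieJaffe1984to88.BIJ85AxialPropagator411 (BondSpace)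
open B4Sect5Torus (IsPseudoDist SumBound)
open B4TorusKernel (periodConst)
open B4TorusKernel.MultiPeriod (torusSupNorm torusSupNorm_nonneg)
open B4Sect5Proof (latticeConst latticeConst_nonneg)
open B5Hk163Strip (kappaN kappaN_pos)
open B5Kernel166Decay (periodConst_pos)
open B6LowerBound2153Torus (rep)
open B6Hprime2132Holder (MGHD)
open B6BlockDecayCalculus (blockBound_comp blockBound_sub blockBound_mono blockBound_of_entry torusDist_isPseudoDist torusDist_sumBound)
open B6BlockDecayHprimeCovV1 (MGHD_nonneg blockBound_gradLapHp blockBound_gradLapHp_adjoint blockBound_C_of_entry cov_entry_uniform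
  supDist_cast_eq_torusSupNorm)
open B6BlockDecayK12V1 (blockBound_comp3)
open B6Repr2129Operator (adjoint_grad_lap_hP)

/-! ## §1  `R = R_j + ΔH′_jC^{(j)}_ΛH′_j*Δ` and `∂P∂* = ∂P_j∂* − (∂ΔH′_j)C^{(j)}_Λ(∂ΔH′_j)*` for every two-scale datum -/

section Abstract

variable {A B W T Bs V : Type*}
  [NormedAddCommGroup A] [InnerProductSpace ℝ A] [FiniteDimensional ℝ A]
  [NormedAddCommGroup B] [InnerProductSpace ℝ B] [FiniteDimensional ℝ B]
  [NormedAddCommGroup W] [InnerProductSpace ℝ W] [FiniteDimensional ℝ W]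
  [NormedAddCommGroup T] [InnerProductSpace ℝ T] [FiniteDimensional ℝ T]
  [NormedAddCommGroup Bs] [InnerProductSpace ℝ Bs] [FiniteDimensional ℝ Bs]
  [NormedAddCommGroup V] [InnerProductSpace ℝ V] [FiniteDimensional ℝ V]
  {D : TwoScaleData A B W T Bs V}

/-- `N(Q′_j) ⊂ N(Q′)`: a gauge function with `Q′_jλ = 0` has the admissible average `0` ((2.105) with `ω = 0`).
[cite: Balaban1984PropagatorsII, (2.95) p.240 + (2.105) p.241] -/
theorem Nj_le_NQ : D.Nj ≤ D.NQ := fun m hm => by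
  rw [Submodule.mem_comap, LinearMap.mem_ker.mp hm]
  exact D.S₁.zero_mem

/-- `ΔN(Q′_j) ⊂ ΔN(Q′)`. [cite: Balaban1984PropagatorsII, (2.97) p.240 + (2.10) p.225] -/
theorem map_Nj_le_map_NQ : D.Nj.map D.lap ≤ D.NQ.map D.lap := Submodule.map_mono Nj_le_NQ

/-- `H′_jC^{(j)}_Λs ∈ N(Q′)`: the covariance `C^{(j)}_Λ` ranges in the admissible `ω` and `H′_jω ∈ N(Q′)` ((2.105) *"λ₀ … belongs to N(Q′)"*).
[cite: Balaban1984PropagatorsII, (2.105) p.241 + (2.110) p.242] -/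
theorem hP_C_mem_NQ (hL : D.IsLattice) (s : W) : D.hP (D.C s) ∈ D.NQ :=
  hP_mem_NQ hL ⟨D.C s, covOp_mem D.S₁ D.Dp s⟩

/-- **(2.98) read on `ΔN(Q′_j)`**: `ΔH′_jw ⊥ ΔN(Q′_j)` for every `w`. [cite: Balaban1984PropagatorsII, (2.98)–(2.102) pp.240–241] -/
theorem lap_hP_mem_orthogonal (hL : D.IsLattice) (w : W) : D.lap (D.hP w) ∈ (D.Nj.map D.lap)ᗮ := by
  rw [Submodule.mem_orthogonal]
  intro u hu
  obtain ⟨n, hn, rfl⟩ := Submodule.mem_map.mp hu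
  exact hL.hP_orth ⟨n, hn⟩ w

/-- `⟨ΔH′_jC^{(j)}_Λs, ΔH′_jω⟩ = ⟨s, ω⟩` for admissible `ω`: `C^{(j)}_Λ` inverts `Δ′_j = H′_j*Δ²H′_j` on the admissible `ω` ((2.107), (2.110)).
[cite: Balaban1984PropagatorsII, (2.106)–(2.110) p.242] -/
theorem inner_lap_hP_C (hL : D.IsLattice) (hP : D.Positive) (s : W) (ω : ↥D.S₁) :
    ⟪D.lap (D.hP (D.C s)), D.lap (D.hP (ω : W))⟫_ℝ = ⟪s, (ω : W)⟫_ℝ := by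
  rw [← inner_Dp hL, ← Dp_symm hL, real_inner_comm, C_sol hL hP ω s, real_inner_comm]

/-- **`R = R_j + ΔH′_jC^{(j)}_ΛH′_j*Δ`** (pointwise): the orthogonal projection onto `ΔN(Q′) = ΔN(Q′_j) ⊕ ΔH′_j(S₁)` — an ORTHOGONAL direct sum by
(2.98) — is the projection `R_j` onto `ΔN(Q′_j)` plus the projection `ΔH′_jC^{(j)}_ΛH′_j*Δ` onto `ΔH′_j(S₁)` (the mechanism of (2.105)–(2.112):
*"we make the translation λ′ → λ′ − C^{(j)}_Λ…"*). [cite: Balaban1984PropagatorsII, (2.105)–(2.112) pp.241–243 + (2.10) p.225] -/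
theorem R_apply_eq (hL : D.IsLattice) (hP : D.Positive) (f : B) :
    D.R f = D.Rj f + D.lap (D.hP (D.C (LinearMap.adjoint D.hP (D.lap f)))) := by
  rw [TwoScaleData.R_apply]
  refine Submodule.eq_starProjection_of_mem_of_inner_eq_zero ?_ ?_
  · -- the candidate lies in `ΔN(Q′)`
    refine Submodule.add_mem _ (map_Nj_le_map_NQ ?_) (Submodule.mem_map_of_mem (hP_C_mem_NQ hL _))
    rw [Rj_apply]
    exact Submodule.starProjection_apply_mem _ f
  · -- `f − candidate ⊥ ΔN(Q′)`: test against `Δ(n + H′_jω)`, `n ∈ N(Q′_j)`, `ω` admissible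
    intro u hu
    obtain ⟨m, hm, rfl⟩ := Submodule.mem_map.mp hu
    obtain ⟨n, ω, hmeq⟩ := NQ_decomp hL ⟨m, hm⟩
    -- `⟨f − R_jf, Δn⟩ = 0`
    have h1 : ⟪f, D.lap (n : B)⟫_ℝ - ⟪D.Rj f, D.lap (n : B)⟫_ℝ = 0 := by
      rw [← inner_sub_left, Rj_apply]
      exact Submodule.starProjection_inner_eq_zero f _ (Submodule.mem_map_of_mem n.2)
    -- `⟨ΔH′_jC…, Δn⟩ = 0` by (2.98)
    have h2 : ⟪D.lap (D.hP (D.C (LinearMap.adjoint D.hP (D.lap f)))), D.lap (n : B)⟫_ℝ = 0 := by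
      rw [real_inner_comm]; exact hL.hP_orth n _
    -- `⟨R_jf, ΔH′_jω⟩ = 0` by (2.98)
    have h3 : ⟪D.Rj f, D.lap (D.hP (ω : W))⟫_ℝ = 0 := by
      rw [Rj_apply]
      exact Submodule.inner_right_of_mem_orthogonal (Submodule.starProjection_apply_mem _ f) (lap_hP_mem_orthogonal hL _)
    -- `⟨ΔH′_jC H′_j*Δf, ΔH′_jω⟩ = ⟨H′_j*Δf, ω⟩ = ⟨f, ΔH′_jω⟩`
    have h4 : ⟪D.lap (D.hP (D.C (LinearMap.adjoint D.hP (D.lap f)))), D.lap (D.hP (ω : W))⟫_ℝ = ⟪f, D.lap (D.hP (ω : W))⟫_ℝ := by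
      rw [inner_lap_hP_C hL hP, LinearMap.adjoint_inner_left, ← lap_symm hL, real_inner_comm]
    rw [show m = (n : B) + D.hP (ω : W) from hmeq, map_add]
    simp only [inner_add_right, inner_sub_left, inner_add_left]
    linarith [h1, h2, h3, h4]

/-- **`R = R_j + ΔH′_jC^{(j)}_ΛH′_j*Δ`** as linear maps. [cite: Balaban1984PropagatorsII, (2.105)–(2.112) pp.241–243 + (2.10) p.225] -/
theorem R_eq_Rj_add (hL : D.IsLattice) (hP : D.Positive) :
    D.R = D.Rj + D.lap ∘ₗ D.hP ∘ₗ D.C ∘ₗ LinearMap.adjoint D.hP ∘ₗ D.lap := by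
  ext f
  rw [R_apply_eq hL hP, LinearMap.add_apply]
  rfl

/-- **`P = P_j − ΔH′_jC^{(j)}_ΛH′_j*Δ`** (`P = I − R` (2.17), `P_j = I − R_j` (2.97)). [cite: Balaban1984PropagatorsII, (2.17) p.226 + (2.97) p.240 + (2.105)–(2.110) pp.241–242] -/
theorem P_eq_Pj_sub (hL : D.IsLattice) (hP : D.Positive) :
    D.P = D.Pj - D.lap ∘ₗ D.hP ∘ₗ D.C ∘ₗ LinearMap.adjoint D.hP ∘ₗ D.lap := by
  ext f
  rw [P_apply, LinearMap.sub_apply, Pj_apply, ← TwoScaleData.R_apply, ← Rj_apply, R_apply_eq hL hP f]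
  simp only [LinearMap.coe_comp, Function.comp_apply]
  abel

/-- **`∂P∂* = ∂P_j∂* − (∂ΔH′_j)C^{(j)}_Λ(∂ΔH′_j)*`** — the two-scale `∂P_□∂*` of (2.90) is the one-level `∂P_j∂*` of [4] (1.120) minus a
`K₂`-type correction built from `∂ΔH′_j` and the covariance `C^{(j)}_Λ` (compare the operators `K₁ = ∂H′_jC^{(j)}_Λ(∂H′_j)*`,
`K₂ = ∂ΔH′_jC^{(j)}_Λ(∂H′_j)*` of (2.129); `(∂ΔH′_j)* = H′_j*Δ∂*` is gen 15's `…B6Repr2129Operator.adjoint_grad_lap_hP`).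
[cite: Balaban1984PropagatorsII, (2.90) p.239 + (2.105)–(2.112) pp.241–243 + (2.129) p.245] -/
theorem gradPdv_eq (hL : D.IsLattice) (hP : D.Positive) :
    D.grad ∘ₗ D.P ∘ₗ D.dv =
      D.grad ∘ₗ D.Pj ∘ₗ D.dv - (D.grad ∘ₗ D.lap ∘ₗ D.hP) ∘ₗ D.C ∘ₗ LinearMap.adjoint (D.grad ∘ₗ D.lap ∘ₗ D.hP) := by
  rw [adjoint_grad_lap_hP hL, P_eq_Pj_sub hL hP]
  ext v
  simp only [LinearMap.coe_comp, Function.comp_apply, LinearMap.sub_apply, map_sub]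

end Abstract

/-! ## §2  The correction `(∂ΔH′_j)C^{(j)}_Λ(∂ΔH′_j)*` has an exponentially decaying block kernel for `tsV1` at `c = L^j`, uniformly -/

section Correction

variable {d L m K : ℕ} {hd : 1 ≤ d + 1} {hL : Odd L ∧ 1 < L} {j : ℕ}

open Classical in
/-- **`(∂ΔH′_j)C^{(j)}_Λ(∂ΔH′_j)*` HAS AN EXPONENTIALLY DECAYING BLOCK KERNEL, UNIFORMLY** (at `c = L^j`): there are `δ > 0`, `C ≥ 0` depending on
`d, L` only such that for every volume `(m, K)`, every `j + 1 ≤ m + K`, every `Λ′ ⊂ T^{(j+1)}`, all positive weights and all fine bonds `b₀`, unit sites `y`: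
`Σ_{b₀′ : y(b₀′₋) = y}|((∂ΔH′_j)C(∂ΔH′_j)*)(e_{b₀′})_{b₀}| ≤ C·e^{−δ|y(b₀₋) − y|_T}` — `T₃` `((d+1)A₃e^{κ}, κ)`, `C^{(j)}_Λ` `(E/n^{d+1}, δ_C)`,
`T₃*` `((d+1)A₃e^{κ}n^{d+1}(d+1), κ)` composed by `blockBound_comp3` (gen 16's `K₂` bound with `T₁*` replaced by `T₃*`).
[cite: Balaban1984PropagatorsII, Prop. 2.5 p.246 («derivatives of H′_j up to third order», «C^{(j)}_Λ … has an exponential decay») + (2.105)–(2.110) pp.241–242] -/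
theorem blockBound_gradLapHp_C_adjoint_scaling (d L : ℕ) (hd : 1 ≤ d + 1) (hL : Odd L ∧ 1 < L) :
    ∃ δ : ℝ, 0 < δ ∧ ∃ C : ℝ, 0 ≤ C ∧ ∀ (m K : ℕ) (j : ℕ) (hc : ((L : ℝ) ^ j) ≠ 0)
      (_hj : j + 1 ≤ (⟨d + 1, L, m, K, hd, hL⟩ : Params).m + (⟨d + 1, L, m, K, hd, hL⟩ : Params).K)
      (Λ' : Finset (Site (⟨d + 1, L, m, K, hd, hL⟩ : Params) (j + 1))) (w : CIdx j Λ' → ℝ) (_hw : ∀ i, 0 < w i)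
      (b₀ : PBond (⟨d + 1, L, m, K, hd, hL⟩ : Params) 0) (y : Site (⟨d + 1, L, m, K, hd, hL⟩ : Params) j),
      ∑ b₀' ∈ univ.filter (fun b₀' : PBond (⟨d + 1, L, m, K, hd, hL⟩ : Params) 0 => iterBlockOf j b₀'.src = y),
          |(((tsV1 hc Λ' w).grad ∘ₗ (tsV1 hc Λ' w).lap ∘ₗ (tsV1 hc Λ' w).hP) ∘ₗ (tsV1 hc Λ' w).C ∘ₗ
              LinearMap.adjoint ((tsV1 hc Λ' w).grad ∘ₗ (tsV1 hc Λ' w).lap ∘ₗ (tsV1 hc Λ' w).hP)) (EuclideanSpace.single b₀' (1 : ℝ)) b₀| ≤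
        C * Real.exp (-(δ * torusSupNorm (Mk (⟨d + 1, L, m, K, hd, hL⟩ : Params) j)
            (rep (Mk (⟨d + 1, L, m, K, hd, hL⟩ : Params) j) (iterBlockOf j b₀.src) - rep (Mk (⟨d + 1, L, m, K, hd, hL⟩ : Params) j) y))) := by
  obtain ⟨δC, hδC, E, hE, hCov⟩ := cov_entry_uniform d L hd hL
  set κH : ℝ := kappaN (d + 1) / ((d : ℝ) + 1) with hκH
  have hκH0 : 0 < κH := div_pos (kappaN_pos _) (by positivity)
  set δ₁ : ℝ := min (δC / 2) κH with hδ₁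
  set δ₂ : ℝ := min (δC / 2) (κH / 2) with hδ₂
  have hδ₁0 : 0 < δ₁ := lt_min (half_pos hδC) hκH0
  have hδ₂0 : 0 < δ₂ := lt_min (half_pos hδC) (half_pos hκH0)
  have hδ₁C : δ₁ < δC := lt_of_le_of_lt (min_le_left _ _) (half_lt_self hδC)
  have hδ₁H : δ₁ ≤ κH := min_le_right _ _
  have hδ₂₁ : δ₂ ≤ δ₁ := le_min (min_le_left _ _) ((min_le_right _ _).trans (half_le_self hκH0.le))
  have hδ₂H : δ₂ < κH := lt_of_le_of_lt (min_le_right _ _) (half_lt_self hκH0)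
  set A₃ : ℝ := ((d + 1 : ℕ) : ℝ) * (MGHD (d + 1) 3 * periodConst (kappaN (d + 1)) d) * Real.exp κH with hA₃
  have hA₃0 : 0 ≤ A₃ := by
    have := MGHD_nonneg (d + 1) 3
    have := periodConst_pos (kappaN_pos (d + 1)) d
    positivity
  set K₁ : ℝ := latticeConst (d + 1) (δC - δ₁) with hK₁
  set K₂ : ℝ := latticeConst (d + 1) (κH - δ₂) with hK₂
  have hK₁0 : 0 ≤ K₁ := latticeConst_nonneg _ (by linarith)
  have hK₂0 : 0 ≤ K₂ := latticeConst_nonneg _ (by linarith)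
  have hL0 : 0 < L := by have := hL.2; omega
  haveI : NeZero L := ⟨by omega⟩
  have hLp : (0 : ℝ) < L := by exact_mod_cast hL0
  set C : ℝ := A₃ * (E * (A₃ * ((d + 1 : ℕ) : ℝ)) * K₁) * K₂ with hC
  have hC0 : 0 ≤ C := by positivity
  refine ⟨δ₂, hδ₂0, C, hC0, ?_⟩
  intro m K j hc hj Λ' w hw b₀ y
  have hj' : j ≤ m + K := Nat.le_of_succ_le hj
  set n : ℝ := ((L : ℝ) ^ j) ^ (d + 1) with hn
  have hn0 : 0 < n := by positivity
  have hLj : (0 : ℝ) < (L : ℝ) ^ j := by positivity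
  have hρ := torusDist_isPseudoDist (Mk (⟨d + 1, L, m, K, hd, hL⟩ : Params) j)
  have hK := torusDist_sumBound (Mk (⟨d + 1, L, m, K, hd, hL⟩ : Params) j)
  have h1 : |(L : ℝ) ^ j| / (L : ℝ) ^ j = 1 := by rw [abs_of_pos hLj, div_self hc]
  have hcast : (((L ^ j) ^ (d + 1) * (d + 1) : ℕ) : ℝ) = n * ((d + 1 : ℕ) : ℝ) := by rw [hn]; push_cast; ring
  have hθ : ((L : ℝ) ^ j / (L : ℝ) ^ j) ^ 4 * ((L : ℝ) ^ j) ^ (d + 1) = n := by rw [div_self hc, one_pow, one_mul]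
  have hT : ∀ (b₀ : PBond (⟨d + 1, L, m, K, hd, hL⟩ : Params) 0) (y : Site (⟨d + 1, L, m, K, hd, hL⟩ : Params) j),
      ∑ y' ∈ univ.filter (fun y' : Site (⟨d + 1, L, m, K, hd, hL⟩ : Params) j => y' = y),
          |((tsV1 hc Λ' w).grad ∘ₗ (tsV1 hc Λ' w).lap ∘ₗ (tsV1 hc Λ' w).hP) (EuclideanSpace.single y' (1 : ℝ)) b₀| ≤
        A₃ * Real.exp (-(κH * torusSupNorm (Mk (⟨d + 1, L, m, K, hd, hL⟩ : Params) j)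
          (rep (Mk (⟨d + 1, L, m, K, hd, hL⟩ : Params) j) (iterBlockOf j b₀.src) - rep (Mk (⟨d + 1, L, m, K, hd, hL⟩ : Params) j) y))) := by
    intro b₀ y
    refine (blockBound_gradLapHp hc hj' Λ' w b₀ y).trans (le_of_eq ?_)
    rw [h1, Nat.cast_one]; ring
  have hTs : ∀ (y' y : Site (⟨d + 1, L, m, K, hd, hL⟩ : Params) j),
      ∑ b₀ ∈ univ.filter (fun b₀ : PBond (⟨d + 1, L, m, K, hd, hL⟩ : Params) 0 => iterBlockOf j b₀.src = y),
          |LinearMap.adjoint ((tsV1 hc Λ' w).grad ∘ₗ (tsV1 hc Λ' w).lap ∘ₗ (tsV1 hc Λ' w).hP) (EuclideanSpace.single b₀ (1 : ℝ)) y'| ≤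
        A₃ * (n * ((d + 1 : ℕ) : ℝ)) * Real.exp (-(κH * torusSupNorm (Mk (⟨d + 1, L, m, K, hd, hL⟩ : Params) j)
          (rep (Mk (⟨d + 1, L, m, K, hd, hL⟩ : Params) j) y' - rep (Mk (⟨d + 1, L, m, K, hd, hL⟩ : Params) j) y))) := by
    intro y' y
    refine (blockBound_gradLapHp_adjoint hc hj' Λ' w y' y).trans (le_of_eq ?_)
    rw [h1, hcast]; ring
  have hCb : ∀ (x y : Site (⟨d + 1, L, m, K, hd, hL⟩ : Params) j),
      ∑ x' ∈ univ.filter (fun x' : Site (⟨d + 1, L, m, K, hd, hL⟩ : Params) j => x' = y), |(tsV1 hc Λ' w).C (EuclideanSpace.single x' (1 : ℝ)) x| ≤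
        E / n * Real.exp (-(δC * torusSupNorm (Mk (⟨d + 1, L, m, K, hd, hL⟩ : Params) j)
          (rep (Mk (⟨d + 1, L, m, K, hd, hL⟩ : Params) j) x - rep (Mk (⟨d + 1, L, m, K, hd, hL⟩ : Params) j) y))) := by
    intro x y
    refine (blockBound_C_of_entry hc Λ' w (E := E / n) (δ := δC) (by positivity) (fun x x' => ?_) x y).trans (le_of_eq ?_)
    · have h := hCov m K ((L : ℝ) ^ j) hc j hj Λ' w hw x x'
      rwa [hθ] at h
    · rw [Nat.cast_one, mul_one]
  have h := blockBound_comp3 hρ hK ((tsV1 hc Λ' w).grad ∘ₗ (tsV1 hc Λ' w).lap ∘ₗ (tsV1 hc Λ' w).hP) (tsV1 hc Λ' w).C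
    (LinearMap.adjoint ((tsV1 hc Λ' w).grad ∘ₗ (tsV1 hc Λ' w).lap ∘ₗ (tsV1 hc Λ' w).hP))
    (fun b₀ : PBond (⟨d + 1, L, m, K, hd, hL⟩ : Params) 0 => iterBlockOf j b₀.src) (fun y : Site (⟨d + 1, L, m, K, hd, hL⟩ : Params) j => y)
    hA₃0 (by positivity : 0 ≤ E / n) (by positivity : 0 ≤ A₃ * (n * ((d + 1 : ℕ) : ℝ))) hK₁0
    hδ₁0.le hδ₁H hδ₁C hδ₂0.le hδ₂₁ hδ₂H hT hCb hTs b₀ y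
  refine h.trans (le_of_eq ?_)
  rw [hC, hK₁, hK₂]
  field_simp

end Correction

/-! ## §3  The one-level `∂P_j∂*` of `tsV1` IS [4]'s `∂P∂*` of (1.120): its entries are the entries of r02's `GradOp·PcT·GradOpᴴ` -/

section OneLevel

open B5Prop11Plancherel (Tor fine)
open B5Action121 (GradOp divS GradOp_conjTranspose_mulVec_eq)
open B5Value126 (PcT)
open B5Identities197Torus (RT RT_mul_GradOp_adjoint)
open B6SectADomainsV1 (Domains)
open B6GOneLevelV1Bridge (TV TS TV_apply bondEK bondEK_apply star_TS_dotProduct_TS divS_TV star_dotProduct_mulVec form_R_TV)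
open B6Eq2130TwoScaleV1Landau (Rj_eq_RE)
open B6HjGtOpNormV1 (qpE_whole_eq_zero_iff)

variable {P : Params} {j : ℕ} (hj' : j ≤ P.m + P.K)

open Classical in
/-- the transport `Ã` of a basis vector `e_b` of the V1 bond space is the basis vector of r02's torus at `(EK b₋, μ(b))`.
[cite: Balaban1984PropagatorsI, (1.18) p.20, dictionary] -/
theorem TV_single (b : PBond P 0) : TV hj' (EuclideanSpace.single b (1 : ℝ)) = Pi.single (bondEK hj' b) (1 : ℂ) := by
  classical
  funext i
  obtain ⟨z, μ⟩ := i
  obtain ⟨src, dir⟩ := b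
  rw [TV_apply, Pi.single_apply, bondEK_apply]
  simp only [PiLp.single_apply, PBond.mk.injEq, Prod.mk.injEq, Equiv.symm_apply_eq]
  split_ifs <;> simp

open Classical in
/-- **matrix entries through the transport**: `ẽ_b† · (A ẽ_{b′}) = A((EK b₋, μ(b)), (EK b′₋, μ(b′)))`. [cite: Balaban1984PropagatorsI, (1.120) p.37 (kernels), dictionary] -/
theorem star_TV_single_dotProduct_mulVec (A : Matrix (Tor (fine (P.L ^ j) (Mk P j)) × Fin P.d) (Tor (fine (P.L ^ j) (Mk P j)) × Fin P.d) ℂ)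
    (b b' : PBond P 0) :
    star (TV hj' (EuclideanSpace.single b (1 : ℝ))) ⬝ᵥ (A *ᵥ TV hj' (EuclideanSpace.single b' (1 : ℝ))) = A (bondEK hj' b) (bondEK hj' b') := by
  classical
  rw [TV_single, TV_single, Matrix.mulVec_single_one, ← Pi.single_star, star_one, single_one_dotProduct]
  rfl

/-- **`⟨∂*A′, ∂*A⟩` across the carriers**: `Ã′†(∂·∂ᴴ)Ã = ⟪∂*A′, ∂*A⟫` at the lattice factor `c = L^j` (r03's `divS_TV`, `star_TS_dotProduct_TS`).
[cite: Balaban1984PropagatorsI, (1.21) p.21 + (1.69) p.29] -/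
theorem form_graddiv_TV (x' x : BondSpace P) :
    star (TV hj' x') ⬝ᵥ ((GradOp (fine (P.L ^ j) (Mk P j)) ((P.L ^ j : ℕ) : ℂ) * (GradOp (fine (P.L ^ j) (Mk P j)) ((P.L ^ j : ℕ) : ℂ))ᴴ) *ᵥ TV hj' x)
      = ((⟪dsE ((P.L : ℝ) ^ j) x', dsE ((P.L : ℝ) ^ j) x⟫_ℝ : ℝ) : ℂ) := by
  rw [← Matrix.mulVec_mulVec, star_dotProduct_mulVec, GradOp_conjTranspose_mulVec_eq, GradOp_conjTranspose_mulVec_eq, divS_TV, divS_TV,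
    star_TS_dotProduct_TS]

/-- `∂·RT·∂ᴴ = ∂·∂ᴴ − ∂·PcT·∂ᴴ` (p21's `RT_mul_GradOp_adjoint`: `RT∂ᴴ = (1 − PcT)∂ᴴ`, the constants being killed by `∂ᴴ`).
[cite: Balaban1984PropagatorsI, (1.69)–(1.70) pp.29–30] -/
theorem GradOp_RT_GradOp_adjoint {d : ℕ} (n : ℕ) [NeZero n] (M : Fin d → ℕ) [∀ μ, NeZero (M μ)] :
    GradOp (fine n M) (n : ℂ) * RT n M * (GradOp (fine n M) (n : ℂ))ᴴ =
      GradOp (fine n M) (n : ℂ) * (GradOp (fine n M) (n : ℂ))ᴴ - GradOp (fine n M) (n : ℂ) * PcT n M (n : ℂ) * (GradOp (fine n M) (n : ℂ))ᴴ := by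
  rw [Matrix.mul_assoc, RT_mul_GradOp_adjoint, Matrix.sub_mul, Matrix.one_mul, Matrix.mul_sub, Matrix.mul_assoc]

open Classical in
/-- **THE ENTRIES OF THE ONE-LEVEL `∂P_j∂*` OF `tsV1` ARE [4]'s**: at `c = L^j`, for all fine bonds `b, b′`,
`(∂P_j∂*)(e_{b′})(b) = (∂·PcT·∂ᴴ)((EK b₋, μ(b)), (EK b′₋, μ(b′)))` — `P_j = I − R_j` (2.97) with `R_j` = r02's `RT = 1 − PcT − Pker` through
gen 9's `Rj_eq_RE` and r03's `form_R_TV` (the (1.70) operator `PcT = Δ⁻¹Q′*(Q′Δ⁻²Q′*)⁻¹Q′Δ⁻¹`).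
[cite: Balaban1984PropagatorsII, (2.97) p.240; Balaban1984PropagatorsI, (1.69)–(1.70) pp.29–30, (1.120) p.37] -/
theorem gradPjdv_single_apply (hc : ((P.L : ℝ) ^ j) ≠ 0) (hj : j + 1 ≤ P.m + P.K) (Λ' : Finset (Site P (j + 1))) {w : CIdx j Λ' → ℝ}
    (hw : ∀ i, 0 < w i) (b b' : PBond P 0) :
    ((((tsV1 hc Λ' w).grad ∘ₗ (tsV1 hc Λ' w).Pj ∘ₗ (tsV1 hc Λ' w).dv) (EuclideanSpace.single b' (1 : ℝ)) b : ℝ) : ℂ) =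
      (GradOp (fine (P.L ^ j) (Mk P j)) ((P.L ^ j : ℕ) : ℂ) * PcT (P.L ^ j) (Mk P j) ((P.L ^ j : ℕ) : ℂ) *
        (GradOp (fine (P.L ^ j) (Mk P j)) ((P.L ^ j : ℕ) : ℂ))ᴴ) (bondEK (Nat.le_of_succ_le hj) b) (bondEK (Nat.le_of_succ_le hj) b') := by
  have hL := isLattice Λ' hc hj hw
  have hj' : j ≤ P.m + P.K := Nat.le_of_succ_le hj
  -- the entry as an inner product `⟨∂*e_b, P_j∂*e_{b′}⟩ = ⟨∂*e_b, ∂*e_{b′}⟩ − ⟨∂*e_b, R_j∂*e_{b′}⟩`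
  have h1 : ((tsV1 hc Λ' w).grad ∘ₗ (tsV1 hc Λ' w).Pj ∘ₗ (tsV1 hc Λ' w).dv) (EuclideanSpace.single b' (1 : ℝ)) b =
      ⟪(tsV1 hc Λ' w).dv (EuclideanSpace.single b (1 : ℝ)), (tsV1 hc Λ' w).dv (EuclideanSpace.single b' (1 : ℝ))⟫_ℝ -
        ⟪(tsV1 hc Λ' w).dv (EuclideanSpace.single b (1 : ℝ)), (tsV1 hc Λ' w).Rj ((tsV1 hc Λ' w).dv (EuclideanSpace.single b' (1 : ℝ)))⟫_ℝ := by
    have e : ((tsV1 hc Λ' w).grad ∘ₗ (tsV1 hc Λ' w).Pj ∘ₗ (tsV1 hc Λ' w).dv) (EuclideanSpace.single b' (1 : ℝ)) b =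
        ⟪EuclideanSpace.single b (1 : ℝ), ((tsV1 hc Λ' w).grad ∘ₗ (tsV1 hc Λ' w).Pj ∘ₗ (tsV1 hc Λ' w).dv) (EuclideanSpace.single b' (1 : ℝ))⟫_ℝ := by
      rw [EuclideanSpace.inner_single_left, map_one, one_mul]
    rw [e, LinearMap.comp_apply, LinearMap.comp_apply, real_inner_comm, hL.grad_adj, real_inner_comm, Pj_apply, ← Rj_apply, inner_sub_right]
  rw [h1, Rj_eq_RE hc Λ' hj', Complex.ofReal_sub]
  change ((⟪dsE ((P.L : ℝ) ^ j) (EuclideanSpace.single b (1 : ℝ)), dsE ((P.L : ℝ) ^ j) (EuclideanSpace.single b' (1 : ℝ))⟫_ℝ : ℝ) : ℂ) -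
      ((⟪dsE ((P.L : ℝ) ^ j) (EuclideanSpace.single b (1 : ℝ)),
          RE (Domains.whole (P := P) j hj') ((P.L : ℝ) ^ j) (dsE ((P.L : ℝ) ^ j) (EuclideanSpace.single b' (1 : ℝ)))⟫_ℝ : ℝ) : ℂ) = _
  rw [← form_graddiv_TV hj', ← form_R_TV hj' (Domains.whole (P := P) j hj') (qpE_whole_eq_zero_iff hj'),
    star_TV_single_dotProduct_mulVec, star_TV_single_dotProduct_mulVec, GradOp_RT_GradOp_adjoint, Matrix.sub_apply, sub_sub_cancel]

end OneLevel

/-! ## §4  [4] (1.126) ⇒ the one-level `∂P_j∂*` has an exponentially decaying block kernel, uniformly; both pieces together -/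

section Scaling

variable {d L : ℕ}

open B5Prop11Plancherel (Tor fine)
open B5Action121 (GradOp)
open B5Value126 (PcT)
open B5Prop12FieldsLattice (distU)
open B6GOneLevelV1Bridge (bondEK bondEK_apply)
open B5PBridgeKernel126 (norm_GradOp_PcT_GradOp_adjoint_le)
open BalabanImbrieJaffe1984to88.BIJ85Prop12BridgeGeometry (distU_EK)
open BalabanImbrieJaffe1984to88.BIJ85Ineq722Torus (mul_supDist_blk_le)
open B6BlockDecayHjCovV1 (card_fiber_src_iterBlockOf_le)

open Classical in
/-- **[4] (1.126) FOR THE ONE-LEVEL `∂P_j∂*` OF `tsV1`, ENTRYWISE, UNIFORMLY** (at `c = L^j`): there are `δ > 0`, `C ≥ 0` depending on `d` only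
(b05's (1.126) through p16's P-bridge) such that for every volume, every `j + 1 ≤ m + K`, every `Λ′`, positive weights and fine bonds `b, b′`:
`|(∂P_j∂*)(e_{b′})(b)| ≤ C·n^{−(d+1)}·e^{−δ|b₋ − b′₋|/n}`, `n = L^j`, `|·|` the sup-distance of the fine torus.
[cite: Balaban1984PropagatorsI, (1.126) p.38 («The constant O(1) in (1.126) depends on d only»), (1.120) p.37] -/
theorem abs_gradPjdv_entry_le (d : ℕ) :
    ∃ δ : ℝ, 0 < δ ∧ ∃ C : ℝ, 0 ≤ C ∧ ∀ (L m K : ℕ) (hd : 1 ≤ d + 1) (hL : Odd L ∧ 1 < L) (j : ℕ) (hc : ((L : ℝ) ^ j) ≠ 0)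
      (hj : j + 1 ≤ (⟨d + 1, L, m, K, hd, hL⟩ : Params).m + (⟨d + 1, L, m, K, hd, hL⟩ : Params).K)
      (Λ' : Finset (Site (⟨d + 1, L, m, K, hd, hL⟩ : Params) (j + 1))) (w : CIdx j Λ' → ℝ) (_hw : ∀ i, 0 < w i)
      (b b' : PBond (⟨d + 1, L, m, K, hd, hL⟩ : Params) 0),
      |((tsV1 hc Λ' w).grad ∘ₗ (tsV1 hc Λ' w).Pj ∘ₗ (tsV1 hc Λ' w).dv) (EuclideanSpace.single b' (1 : ℝ)) b| ≤
        C * (((L : ℝ) ^ j) ^ (d + 1))⁻¹ * Real.exp (-(δ * ((supDist b.src b'.src : ℕ) : ℝ) / (L : ℝ) ^ j)) := by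
  obtain ⟨δ, C, hδ, hC, h⟩ := norm_GradOp_PcT_GradOp_adjoint_le d
  refine ⟨δ, hδ, C, hC, fun L m K hd hL j hc hj Λ' w hw b b' => ?_⟩
  haveI : NeZero L := ⟨by have := hL.2; omega⟩
  have hj' : j ≤ (⟨d + 1, L, m, K, hd, hL⟩ : Params).m + (⟨d + 1, L, m, K, hd, hL⟩ : Params).K := Nat.le_of_succ_le hj
  have hent := gradPjdv_single_apply (P := (⟨d + 1, L, m, K, hd, hL⟩ : Params)) hc hj Λ' hw b b'
  have hre : ((tsV1 hc Λ' w).grad ∘ₗ (tsV1 hc Λ' w).Pj ∘ₗ (tsV1 hc Λ' w).dv) (EuclideanSpace.single b' (1 : ℝ)) b =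
      ((GradOp (fine ((⟨d + 1, L, m, K, hd, hL⟩ : Params).L ^ j) (Mk (⟨d + 1, L, m, K, hd, hL⟩ : Params) j))
          (((⟨d + 1, L, m, K, hd, hL⟩ : Params).L ^ j : ℕ) : ℂ) *
        PcT ((⟨d + 1, L, m, K, hd, hL⟩ : Params).L ^ j) (Mk (⟨d + 1, L, m, K, hd, hL⟩ : Params) j) (((⟨d + 1, L, m, K, hd, hL⟩ : Params).L ^ j : ℕ) : ℂ) *
        (GradOp (fine ((⟨d + 1, L, m, K, hd, hL⟩ : Params).L ^ j) (Mk (⟨d + 1, L, m, K, hd, hL⟩ : Params) j))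
          (((⟨d + 1, L, m, K, hd, hL⟩ : Params).L ^ j : ℕ) : ℂ))ᴴ) (bondEK hj' b) (bondEK hj' b')).re := by
    rw [← hent, Complex.ofReal_re]
  rw [hre]
  refine (Complex.abs_re_le_norm _).trans ((h _ _ (bondEK hj' b) (bondEK hj' b')).trans (le_of_eq ?_))
  rw [bondEK_apply, bondEK_apply]
  simp only
  rw [distU_EK hj']
  push_cast
  ring_nf

open Classical in
/-- **THE ONE-LEVEL `∂P_j∂*` OF `tsV1` HAS AN EXPONENTIALLY DECAYING BLOCK KERNEL, UNIFORMLY** (at `c = L^j`): there are `δ > 0`, `C ≥ 0`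
depending on `d, L` only such that for every volume, `j + 1 ≤ m + K`, `Λ′`, positive weights, fine bonds `b₀` and unit sites `y`:
`Σ_{b₀′ : y(b₀′₋) = y}|(∂P_j∂*)(e_{b₀′})(b₀)| ≤ C·e^{−δ|y(b₀₋) − y|_T}` — [4] (1.126) entrywise (`abs_gradPjdv_entry_le`), the fine distance turned
into the block distance (`L^j|x_j − x′_j| ≤ |x − x′| + L^j − 1`, p09's `mul_supDist_blk_le`), summed over the `≤ n^{d+1}(d+1)` bonds of a block.
[cite: Balaban1984PropagatorsI, (1.126) p.38; Balaban1984PropagatorsII, (2.88) p.238 (one level)] -/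
theorem blockBound_gradPjdv_scaling (d L : ℕ) (hd : 1 ≤ d + 1) (hL : Odd L ∧ 1 < L) :
    ∃ δ : ℝ, 0 < δ ∧ ∃ C : ℝ, 0 ≤ C ∧ ∀ (m K : ℕ) (j : ℕ) (hc : ((L : ℝ) ^ j) ≠ 0)
      (_hj : j + 1 ≤ (⟨d + 1, L, m, K, hd, hL⟩ : Params).m + (⟨d + 1, L, m, K, hd, hL⟩ : Params).K)
      (Λ' : Finset (Site (⟨d + 1, L, m, K, hd, hL⟩ : Params) (j + 1))) (w : CIdx j Λ' → ℝ) (_hw : ∀ i, 0 < w i)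
      (b₀ : PBond (⟨d + 1, L, m, K, hd, hL⟩ : Params) 0) (y : Site (⟨d + 1, L, m, K, hd, hL⟩ : Params) j),
      ∑ b₀' ∈ univ.filter (fun b₀' : PBond (⟨d + 1, L, m, K, hd, hL⟩ : Params) 0 => iterBlockOf j b₀'.src = y),
          |((tsV1 hc Λ' w).grad ∘ₗ (tsV1 hc Λ' w).Pj ∘ₗ (tsV1 hc Λ' w).dv) (EuclideanSpace.single b₀' (1 : ℝ)) b₀| ≤
        C * Real.exp (-(δ * torusSupNorm (Mk (⟨d + 1, L, m, K, hd, hL⟩ : Params) j)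
            (rep (Mk (⟨d + 1, L, m, K, hd, hL⟩ : Params) j) (iterBlockOf j b₀.src) - rep (Mk (⟨d + 1, L, m, K, hd, hL⟩ : Params) j) y))) := by
  obtain ⟨δ, hδ, C, hC, h⟩ := abs_gradPjdv_entry_le d
  refine ⟨δ, hδ, C * Real.exp δ * (((d + 1 : ℕ) : ℝ)), by positivity, ?_⟩
  intro m K j hc hj Λ' w hw b₀ y
  have hj' : j ≤ m + K := Nat.le_of_succ_le hj
  have hL0 : 0 < L := by have := hL.2; omega
  have hLj : (0 : ℝ) < (L : ℝ) ^ j := pow_pos (by exact_mod_cast hL0) _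
  set n : ℝ := ((L : ℝ) ^ j) ^ (d + 1) with hn
  have hn0 : 0 < n := by positivity
  -- the entry bound at the block distance
  have hent : ∀ (b : PBond (⟨d + 1, L, m, K, hd, hL⟩ : Params) 0) (b' : PBond (⟨d + 1, L, m, K, hd, hL⟩ : Params) 0),
      |((tsV1 hc Λ' w).grad ∘ₗ (tsV1 hc Λ' w).Pj ∘ₗ (tsV1 hc Λ' w).dv) (EuclideanSpace.single b' (1 : ℝ)) b| ≤
        C * n⁻¹ * Real.exp δ * Real.exp (-(δ * torusSupNorm (Mk (⟨d + 1, L, m, K, hd, hL⟩ : Params) j)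
          (rep (Mk (⟨d + 1, L, m, K, hd, hL⟩ : Params) j) (iterBlockOf j b.src) - rep (Mk (⟨d + 1, L, m, K, hd, hL⟩ : Params) j) (iterBlockOf j b'.src)))) := by
    intro b b'
    refine (h L m K hd hL j hc hj Λ' w hw b b').trans ?_
    rw [mul_assoc (C * n⁻¹), ← Real.exp_add]
    refine mul_le_mul_of_nonneg_left (Real.exp_le_exp.2 ?_) (by positivity)
    rw [← supDist_cast_eq_torusSupNorm]
    -- `L^j·|x_j − x′_j| ≤ |x − x′| + L^j − 1`
    have hblk := mul_supDist_blk_le (P := (⟨d + 1, L, m, K, hd, hL⟩ : Params)) hj' b.src b'.src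
    have hpow : 1 ≤ L ^ j := Nat.one_le_pow _ _ hL0
    have hcast : (L : ℝ) ^ j * (supDist (iterBlockOf j b.src) (iterBlockOf j b'.src) : ℝ) ≤ (supDist b.src b'.src : ℝ) + ((L : ℝ) ^ j - 1) := by
      have h' : ((L ^ j * supDist (iterBlockOf j b.src) (iterBlockOf j b'.src) : ℕ) : ℝ) ≤ ((supDist b.src b'.src + (L ^ j - 1) : ℕ) : ℝ) := by
        exact_mod_cast hblk
      push_cast [Nat.cast_sub hpow] at h'
      linarith
    rw [neg_mul_eq_neg_mul] at *
    have hD : (supDist (iterBlockOf j b.src) (iterBlockOf j b'.src) : ℝ) - 1 ≤ (supDist b.src b'.src : ℝ) / (L : ℝ) ^ j := by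
      rw [le_div_iff₀ hLj]
      nlinarith
    have hδD := mul_le_mul_of_nonneg_left hD hδ.le
    rw [mul_div_assoc]
    linarith
  have key := blockBound_of_entry (ρ := (fun t t' : Site (⟨d + 1, L, m, K, hd, hL⟩ : Params) j =>
      torusSupNorm (Mk (⟨d + 1, L, m, K, hd, hL⟩ : Params) j) (rep (Mk (⟨d + 1, L, m, K, hd, hL⟩ : Params) j) t - rep (Mk (⟨d + 1, L, m, K, hd, hL⟩ : Params) j) t')))
    ((tsV1 hc Λ' w).grad ∘ₗ (tsV1 hc Λ' w).Pj ∘ₗ (tsV1 hc Λ' w).dv)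
    (fun b₀ : PBond (⟨d + 1, L, m, K, hd, hL⟩ : Params) 0 => iterBlockOf j b₀.src) (fun b₀ : PBond (⟨d + 1, L, m, K, hd, hL⟩ : Params) 0 => iterBlockOf j b₀.src)
    (A := C * n⁻¹ * Real.exp δ) (by positivity) (card_fiber_src_iterBlockOf_le (P := (⟨d + 1, L, m, K, hd, hL⟩ : Params)) hj') hent b₀ y
  refine key.trans (le_of_eq ?_)
  have hcast : (((L ^ j) ^ (d + 1) * (d + 1) : ℕ) : ℝ) = n * ((d + 1 : ℕ) : ℝ) := by rw [hn]; push_cast; ring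
  rw [show (((⟨d + 1, L, m, K, hd, hL⟩ : Params).L ^ j) ^ (⟨d + 1, L, m, K, hd, hL⟩ : Params).d * (⟨d + 1, L, m, K, hd, hL⟩ : Params).d : ℕ) =
      ((L ^ j) ^ (d + 1) * (d + 1) : ℕ) from rfl, hcast]
  field_simp

open Classical in
/-- **(2.88) FOR THE GENUINE TWO-SCALE `P_□` OF (2.90) — THE BLOCK KERNEL OF `∂P_□∂*` DECAYS EXPONENTIALLY, UNIFORMLY**: there are `δ > 0`, `A ≥ 0`
depending on `d, L` only such that for every volume `(m, K)`, every `j + 1 ≤ m + K`, every `Λ′ ⊂ T^{(j+1)}`, all positive weights `w`, all fine bonds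
`b₀` and unit sites `y ∈ T^{(j)}` (`P = (tsV1 hc Λ′ w).P`, `c = L^j`):
`Σ_{b₀′ : y(b₀′₋) = y}|(∂P∂*)(e_{b₀′})(b₀)| ≤ A·e^{−δ|y(b₀₋) − y|_T}` — §1's split + `blockBound_gradPjdv_scaling` + `blockBound_gradLapHp_C_adjoint_scaling`.
[cite: Balaban1984PropagatorsII, (2.88) p.238 + (2.90) p.239 («Let us denote by P_□ the projection operator in (2.17) defined by the above Q′*aQ′»)] -/
theorem blockBound_gradPdv_scaling (d L : ℕ) (hd : 1 ≤ d + 1) (hL : Odd L ∧ 1 < L) :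
    ∃ δ : ℝ, 0 < δ ∧ ∃ A : ℝ, 0 ≤ A ∧ ∀ (m K : ℕ) (j : ℕ) (hc : ((L : ℝ) ^ j) ≠ 0)
      (_hj : j + 1 ≤ (⟨d + 1, L, m, K, hd, hL⟩ : Params).m + (⟨d + 1, L, m, K, hd, hL⟩ : Params).K)
      (Λ' : Finset (Site (⟨d + 1, L, m, K, hd, hL⟩ : Params) (j + 1))) (w : CIdx j Λ' → ℝ) (_hw : ∀ i, 0 < w i)
      (b₀ : PBond (⟨d + 1, L, m, K, hd, hL⟩ : Params) 0) (y : Site (⟨d + 1, L, m, K, hd, hL⟩ : Params) j),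
      ∑ b₀' ∈ univ.filter (fun b₀' : PBond (⟨d + 1, L, m, K, hd, hL⟩ : Params) 0 => iterBlockOf j b₀'.src = y),
          |((tsV1 hc Λ' w).grad ∘ₗ (tsV1 hc Λ' w).P ∘ₗ (tsV1 hc Λ' w).dv) (EuclideanSpace.single b₀' (1 : ℝ)) b₀| ≤
        A * Real.exp (-(δ * torusSupNorm (Mk (⟨d + 1, L, m, K, hd, hL⟩ : Params) j)
            (rep (Mk (⟨d + 1, L, m, K, hd, hL⟩ : Params) j) (iterBlockOf j b₀.src) - rep (Mk (⟨d + 1, L, m, K, hd, hL⟩ : Params) j) y))) := by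
  obtain ⟨δ₁, hδ₁, C₁, hC₁, h₁⟩ := blockBound_gradPjdv_scaling d L hd hL
  obtain ⟨δ₂, hδ₂, C₂, hC₂, h₂⟩ := blockBound_gradLapHp_C_adjoint_scaling d L hd hL
  refine ⟨min δ₁ δ₂, lt_min hδ₁ hδ₂, C₁ + C₂, by positivity, ?_⟩
  intro m K j hc hj Λ' w hw b₀ y
  have hρ : IsPseudoDist (fun t t' : Site (⟨d + 1, L, m, K, hd, hL⟩ : Params) j =>
      torusSupNorm (Mk (⟨d + 1, L, m, K, hd, hL⟩ : Params) j)
        (rep (Mk (⟨d + 1, L, m, K, hd, hL⟩ : Params) j) t - rep (Mk (⟨d + 1, L, m, K, hd, hL⟩ : Params) j) t')) :=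
    torusDist_isPseudoDist (Mk (⟨d + 1, L, m, K, hd, hL⟩ : Params) j)
  rw [gradPdv_eq (isLattice Λ' hc hj hw) (positive Λ' hc hj w)]
  exact blockBound_sub (ρ := fun t t' : Site (⟨d + 1, L, m, K, hd, hL⟩ : Params) j =>
      torusSupNorm (Mk (⟨d + 1, L, m, K, hd, hL⟩ : Params) j)
        (rep (Mk (⟨d + 1, L, m, K, hd, hL⟩ : Params) j) t - rep (Mk (⟨d + 1, L, m, K, hd, hL⟩ : Params) j) t')) _ _
    (fun b₀ : PBond (⟨d + 1, L, m, K, hd, hL⟩ : Params) 0 => iterBlockOf j b₀.src)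
    (fun b₀ : PBond (⟨d + 1, L, m, K, hd, hL⟩ : Params) 0 => iterBlockOf j b₀.src)
    (blockBound_mono hρ _ (fun b₀ : PBond (⟨d + 1, L, m, K, hd, hL⟩ : Params) 0 => iterBlockOf j b₀.src)
      (fun b₀ : PBond (⟨d + 1, L, m, K, hd, hL⟩ : Params) 0 => iterBlockOf j b₀.src) hC₁ le_rfl (min_le_left δ₁ δ₂)
      (fun b y => h₁ m K j hc hj Λ' w hw b y))
    (blockBound_mono hρ _ (fun b₀ : PBond (⟨d + 1, L, m, K, hd, hL⟩ : Params) 0 => iterBlockOf j b₀.src)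
      (fun b₀ : PBond (⟨d + 1, L, m, K, hd, hL⟩ : Params) 0 => iterBlockOf j b₀.src) hC₂ le_rfl (min_le_right δ₁ δ₂)
      (fun b y => h₂ m K j hc hj Λ' w hw b y)) b₀ y

end Scaling

/-! ## §5  The consumer readings: (2.88) as a majorant on the census geometry of the two-scale family -/

section Majorant

open B6RandomWalk (HasMajorant)
open B6Prop26Gluing (LocalMajorant localMajorant_of_hasMajorant)
open B6Prop25TwoScaleCensus (TSIdx)
open B6Ineq2133TwoScaleV1 (tsGeo onFun hasMajorant_of_blockBound)

variable {d L : ℕ} {hd : 1 ≤ d + 1} {hL : Odd L ∧ 1 < L} {a₀ a₁ : ℝ}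

/-- **(2.88) FOR THE GENUINE TWO-SCALE `P_□`, MAJORANT SHAPE**: there are `δ > 0` and `A ≥ 0` depending on `d, L` only such that for EVERY member `i`
of the two-scale family (r03's census index: every volume, scale `j + 1 ≤ m + K`, `Λ′ ⊂ T^{(j+1)}`, weights in the window of [4], `a₀ > 0`) the
transported `∂P_□∂*` — `onFun (∂ ∘ P ∘ ∂*)` on the bond functions of the member torus — has the majorant `A·e^{−δ|y − y′|_T}` on the geometry
`tsGeo i R M` (p38's (2.133) conventions): `|(∂P_□∂*μ)(x)| ≤ A·e^{−δ|y(x) − y′|_T}·B` whenever `supp μ ⊂ B(y′)`, `|μ| ≤ B` — the shape of the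
line-4 partner hypothesis `hPl` of `…B6Ineq2134DiagKLevel.ineq2134_diag_kLevel` on the member torus (`L^jη = 1`).
[cite: Balaban1984PropagatorsII, (2.88) p.238 + (2.90)–(2.92) p.239 + (2.134) p.247] -/
theorem ineq288_twoScale (d L : ℕ) (hd : 1 ≤ d + 1) (hL : Odd L ∧ 1 < L) {a₀ a₁ : ℝ} (ha₀ : 0 < a₀) :
    ∃ δ : ℝ, 0 < δ ∧ ∃ A : ℝ, 0 ≤ A ∧ ∀ (i : TSIdx d L hd hL a₀ a₁) (R M : ℝ),
      HasMajorant (g := tsGeo i R M) (fun b : PBond i.P 0 => iterBlockOf i.j b.src) (onFun (i.D.grad ∘ₗ i.D.P ∘ₗ i.D.dv))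
        (fun y y' => A * Real.exp (-(δ * i.tdist y y'))) := by
  obtain ⟨δ, hδ, A, hA, h⟩ := blockBound_gradPdv_scaling d L hd hL
  refine ⟨δ, hδ, A, hA, fun i R M => hasMajorant_of_blockBound i R M (i.D.grad ∘ₗ i.D.P ∘ₗ i.D.dv) fun b y => ?_⟩
  exact h i.m i.K i.j i.hc i.hj i.Λ' i.w (i.w_pos ha₀) b y

/-- **(2.88) FOR THE GENUINE TWO-SCALE `P_□`, LOCAL SHAPE** on an arbitrary reach set `S ⊂ T^{(j)}` (the `LocalMajorant` form of the gluing files).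
[cite: Balaban1984PropagatorsII, (2.88) p.238 + (2.134) p.247] -/
theorem ineq288_twoScale_local (d L : ℕ) (hd : 1 ≤ d + 1) (hL : Odd L ∧ 1 < L) {a₀ a₁ : ℝ} (ha₀ : 0 < a₀) :
    ∃ δ : ℝ, 0 < δ ∧ ∃ A : ℝ, 0 ≤ A ∧ ∀ (i : TSIdx d L hd hL a₀ a₁) (R M : ℝ) (S : Set (Site i.P i.j)),
      LocalMajorant (g := tsGeo i R M) (fun b : PBond i.P 0 => iterBlockOf i.j b.src) (onFun (i.D.grad ∘ₗ i.D.P ∘ₗ i.D.dv)) S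
        (fun y y' => A * Real.exp (-(δ * i.tdist y y'))) := by
  obtain ⟨δ, hδ, A, hA, h⟩ := ineq288_twoScale d L hd hL (a₁ := a₁) ha₀
  exact ⟨δ, hδ, A, hA, fun i R M S => localMajorant_of_hasMajorant (g := tsGeo i R M) _ (h i R M) S⟩

end Majorant

end Literature.MathematicalPhysics.QuantumFieldTheory.Balaban1983to89.B6Ineq288TwoScaleV1

end
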